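import Summits.ResolutionOfSingularities.ResolutionOfSingularities.Theorems.LossPolygon2
import HarnessLib

/-!
# LossPolygon3 — F-isolation feeds the residual polygon: non-emptiness, `α < 1` / `ε < 1`, strict `β` / `ζ` drops

decomp-res-lens-3, gen 27, slice 3 of `g27/LossPolygon.lean` (§6; slices 1–2 = `Theorems.LossPolygon`, `Theorems.LossPolygon2`).
Critic row 220e (P1): function-valued invariants of the run state + their PROVED laws = admissible tools at 0.

From `ConeCutAxisLaw.axis_law` (the origin is an isolated top point at every stage): for the frame `(a, b ; c)` of
`LossPolygon.polyPts`, a HEAVY first wall `q ≤ s + r a` gives a non-empty point set with `α < 1`, hence a STRICT drop of `β`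
at every untranslated letter in the chart `b` (`Ψ₍₀:₁₎`, (M1) of SEED-g28 §1 (B″)); a heavy second wall gives `ε < 1` and a
strict drop of `ζ` at every untranslated letter in the chart `a` (`Ψ₍₁:₀₎`, (M3)).
-/

open MvPolynomial Finset
open Literature.AlgebraicGeometry.Resolution
open Literature.AlgebraicGeometry.Resolution.Hauser2010
open Literature.AlgebraicGeometry.Resolution.PointBlowup
open Summit.ResolutionOfSingularities.ResolutionOfSingularities.Theorems.TightDefectClasses
open Summit.ResolutionOfSingularities.ResolutionOfSingularities.Theorems.TightDefectStrongWalks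
open Summit.ResolutionOfSingularities.ResolutionOfSingularities.Theorems.ItineraryCutClasses
open Summit.ResolutionOfSingularities.ResolutionOfSingularities.Theorems.BoundaryLedger
open Summit.ResolutionOfSingularities.ResolutionOfSingularities.Theorems.ProximityCut
open Summit.ResolutionOfSingularities.ResolutionOfSingularities.Theorems.LossExitCone

namespace Summit.ResolutionOfSingularities.ResolutionOfSingularities.Theorems.LossPolygon

variable {K : Type} [Field K] [DecidableEq K]
variable {q : ℕ} {s₀ : State (Fin 3) K}

/-! ## §6 F-isolation feeds the polygon: non-emptiness and `α < 1` / `ε < 1` from the axis law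

At every stage the origin is an isolated top point, so for every pair of letters `(x, y)` some monomial has `D x + D y < q`
(`ConeCutAxisLaw.axis_law`).  For the frame `(a, b ; c)` this gives: if the wall `a` is HEAVY, `q ≤ s + r a` (for the loss wall
`m ≥ q − s ⟺ d ≥ 0`), then the point set is non-empty and `α < 1` — so `β` drops by `1 − α > 0` at every `Ψ₍₀:₁₎`-letter
(SEED-g28 §1 (B″) (M1)); symmetrically `q ≤ s + r b` gives `ε < 1`. -/

section Isolation

variable {a b c : Fin 3} {s : ℕ}

/-- The abscissa of the vertex is below the abscissa of every point. [folklore] -/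
theorem alphaOf_le_fst {S : Finset (ℚ × ℚ)} {x : ℚ × ℚ} (hx : x ∈ S) : alphaOf S ≤ x.1 := by
  have h := vertexOf_le hx
  rw [toLex_le_toLex_iff] at h
  unfold alphaOf
  rcases h with h | ⟨h, _⟩
  · exact le_of_lt h
  · exact le_of_eq h

omit [DecidableEq K] in
/-- Swapping the frame letters swaps the point set. [folklore] -/
theorem polyPts_swap (s : ℕ) (r : Fin 3 →₀ ℕ) (a b c : Fin 3) (F : MvPolynomial (Fin 3) K) :
    (polyPts s r a b c F).image Prod.swap = polyPts s r b a c F := by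
  classical
  unfold polyPts
  rw [Finset.image_image]
  exact Finset.image_congr fun D _ => (resPoint_swap s r a b c D).symm

omit [DecidableEq K] in
/-- `ε` of a frame is `α` of the swapped frame. [folklore] -/
theorem epsOf_polyPts (s : ℕ) (r : Fin 3 →₀ ℕ) (a b c : Fin 3) (F : MvPolynomial (Fin 3) K) :
    epsOf (polyPts s r a b c F) = alphaOf (polyPts s r b a c F) := by
  unfold epsOf; rw [polyPts_swap]

omit [DecidableEq K] in
/-- `ζ` of a frame is `β` of the swapped frame. [folklore] -/
theorem zetaOf_polyPts (s : ℕ) (r : Fin 3 →₀ ℕ) (a b c : Fin 3) (F : MvPolynomial (Fin 3) K) :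
    zetaOf (polyPts s r a b c F) = betaOf (polyPts s r b a c F) := by
  unfold zetaOf; rw [polyPts_swap]

/-- **The axis law in the frame (PROVED):** if the wall `a` is heavy (`q ≤ s + r a`) then some monomial of `F_t` lies below the
ceiling of the frame `(a, · ; c)` and strictly inside the simplex `D a + D c < s + r a`. [new; from `ConeCutAxisLaw.axis_law`] -/
theorem exists_thin_mem_support (hs : IsRoot q s₀) (W : ForcedWalk q s₀) (t : ℕ) (hac : a ≠ c)
    (hq : q ≤ s + (W.st t).r a) (hrc : (W.st t).r c = 0) :
    ∃ D ∈ (W.st t).F.support, D c < s + (W.st t).r c ∧ D a + D c < s + (W.st t).r a := by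
  obtain ⟨D, hD, hlt⟩ := ConeCutAxisLaw.axis_law W t a c hac
  have hra : (W.st t).r a ≤ D a := Finsupp.le_def.mp (walk_r hs W t D hD) a
  refine ⟨D, hD, ?_, ?_⟩
  · rw [hrc]; omega
  · omega

/-- **Non-emptiness (PROVED):** under a heavy wall `a` the point set of the frame `(a, b ; c)` is non-empty. [new] -/
theorem polyPts_nonempty_of_heavy_fst (hs : IsRoot q s₀) (W : ForcedWalk q s₀) (t : ℕ) (hac : a ≠ c) (b : Fin 3)
    (hq : q ≤ s + (W.st t).r a) (hrc : (W.st t).r c = 0) :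
    (polyPts s (W.st t).r a b c (W.st t).F).Nonempty := by
  classical
  obtain ⟨D, hD, hDc, _⟩ := exists_thin_mem_support hs W t hac hq hrc
  exact ⟨_, Finset.mem_image_of_mem _ (Finset.mem_filter.mpr ⟨hD, hDc⟩)⟩

/-- … and symmetrically under a heavy wall `b`. [new] -/
theorem polyPts_nonempty_of_heavy_snd (hs : IsRoot q s₀) (W : ForcedWalk q s₀) (t : ℕ) (hbc : b ≠ c) (a : Fin 3)
    (hq : q ≤ s + (W.st t).r b) (hrc : (W.st t).r c = 0) :
    (polyPts s (W.st t).r a b c (W.st t).F).Nonempty := by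
  classical
  have h := polyPts_nonempty_of_heavy_fst hs W t hbc a hq hrc
  rw [← polyPts_swap, Finset.image_nonempty] at h
  exact h

/-- **`α < 1` UNDER A HEAVY FIRST WALL (PROVED)** — quasi-isolation along the `u₂`-axis in CJS's language [CJS2020 (11.3)], here
a CONSEQUENCE of F-isolation: `q ≤ s + r a` forces `α(Δ) < 1`, so `β` strictly drops at every `Ψ₍₀:₁₎`-letter
(`betaOf_image_psi01_lt_iff`). [new] -/
theorem alphaOf_polyPts_lt_one (hs : IsRoot q s₀) (W : ForcedWalk q s₀) (t : ℕ) (hac : a ≠ c) (b : Fin 3)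
    (hq : q ≤ s + (W.st t).r a) (hrc : (W.st t).r c = 0) :
    alphaOf (polyPts s (W.st t).r a b c (W.st t).F) < 1 := by
  classical
  obtain ⟨D, hD, hDc, hthin⟩ := exists_thin_mem_support hs W t hac hq hrc
  have hmem : resPoint s (W.st t).r a b c D ∈ polyPts s (W.st t).r a b c (W.st t).F :=
    Finset.mem_image_of_mem _ (Finset.mem_filter.mpr ⟨hD, hDc⟩)
  refine lt_of_le_of_lt (alphaOf_le_fst hmem) ?_
  show (((D a : ℕ) : ℚ) - (W.st t).r a) / (((s : ℕ) : ℚ) + (W.st t).r c - D c) < 1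
  rw [hrc] at hDc
  have hden : (0 : ℚ) < ((s : ℕ) : ℚ) + (W.st t).r c - D c := by
    rw [hrc]; push_cast
    have : ((D c : ℕ) : ℚ) < s := by exact_mod_cast (by omega : D c < s)
    linarith
  rw [div_lt_one hden, hrc]
  push_cast
  have : ((D a : ℕ) : ℚ) + D c < s + (W.st t).r a := by exact_mod_cast hthin
  linarith

/-- **`ε < 1` UNDER A HEAVY SECOND WALL (PROVED)** — the mirror statement: `q ≤ s + r b` forces `ε(Δ) < 1`, so `ζ` strictly drops
at every `Ψ₍₁:₀₎`-letter (`zetaOf_image_psi10_lt_iff`). [new] -/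
theorem epsOf_polyPts_lt_one (hs : IsRoot q s₀) (W : ForcedWalk q s₀) (t : ℕ) (hbc : b ≠ c) (a : Fin 3)
    (hq : q ≤ s + (W.st t).r b) (hrc : (W.st t).r c = 0) :
    epsOf (polyPts s (W.st t).r a b c (W.st t).F) < 1 := by
  rw [epsOf_polyPts]
  exact alphaOf_polyPts_lt_one hs W t hbc a hq hrc

/-- **STRICT β-DROP AT AN R-LETTER / REPEAT UNDER A HEAVY LOSS WALL (PROVED):** untranslated move in the chart of the second
frame letter with the run-state wall bookkeeping and `q ≤ s + r a` ⇒ `β' < β` (by exactly `1 − α > 0`).  This is (M1) of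
SEED-g28 §1 (B″) in kernel. [new] -/
theorem betaOf_polyPts_succ_chart_snd_lt (hs : IsRoot q s₀) (W : ForcedWalk q s₀) (t : ℕ) (hab : a ≠ b) (hac : a ≠ c)
    (hbc : b ≠ c) (hj : W.j t = b) (hb : W.b t = 0)
    (hra : (W.st (t + 1)).r a = (W.st t).r a) (hrb : (W.st (t + 1)).r b + q = s + (W.st t).r a + (W.st t).r b)
    (hrc : (W.st t).r c = 0) (hrc' : (W.st (t + 1)).r c = 0) (hq : q ≤ s + (W.st t).r a) :
    betaOf (polyPts s (W.st (t + 1)).r a b c (W.st (t + 1)).F) < betaOf (polyPts s (W.st t).r a b c (W.st t).F) := by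
  have hne := polyPts_nonempty_of_heavy_fst hs W t hac b hq hrc
  rw [polyPts_succ_chart_snd hs W t hab hac hbc hj hb hra hrb hrc hrc', betaOf_image_psi01_lt_iff hne]
  exact alphaOf_polyPts_lt_one hs W t hac b hq hrc

/-- **STRICT ζ-DROP AT AN UNTRANSLATED KEPT EXIT UNDER A HEAVY RUN WALL (PROVED):** chart of the first frame letter, `q ≤ s + r b`
⇒ `ζ' < ζ` (by exactly `1 − ε > 0`), while `β' = γ⁻ ≤ β`.  (M3) of SEED-g28 §1 (B″) in kernel. [new] -/
theorem zetaOf_polyPts_succ_chart_fst_lt (hs : IsRoot q s₀) (W : ForcedWalk q s₀) (t : ℕ) (hab : a ≠ b) (hac : a ≠ c)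
    (hbc : b ≠ c) (hj : W.j t = a) (hb : W.b t = 0)
    (hrb : (W.st (t + 1)).r b = (W.st t).r b) (hra : (W.st (t + 1)).r a + q = s + (W.st t).r a + (W.st t).r b)
    (hrc : (W.st t).r c = 0) (hrc' : (W.st (t + 1)).r c = 0) (hq : q ≤ s + (W.st t).r b) :
    zetaOf (polyPts s (W.st (t + 1)).r a b c (W.st (t + 1)).F) < zetaOf (polyPts s (W.st t).r a b c (W.st t).F) := by
  have hne := polyPts_nonempty_of_heavy_snd hs W t hbc a hq hrc
  rw [polyPts_succ_chart_fst hs W t hab hac hbc hj hb hrb hra hrc hrc', zetaOf_image_psi10_lt_iff hne]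
  exact epsOf_polyPts_lt_one hs W t hbc a hq hrc

end Isolation

end Summit.ResolutionOfSingularities.ResolutionOfSingularities.Theorems.LossPolygon
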